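import Summits.CriticalPhenomena.Ising3D.Control2DTaylorCertificate
import Summits.CriticalPhenomena.Ising3D.Control2DGammaL7Cells1005A3
import Summits.CriticalPhenomena.Ising3D.Control2DGammaL7Cells1005B3
import Summits.CriticalPhenomena.Ising3D.Control2DGammaL7Cells1005C2
import Summits.CriticalPhenomena.Ising3D.Control2DGammaL7Cells1005D
import Summits.CriticalPhenomena.Ising3D.Control2DGammaL7Cells1005E
import Summits.CriticalPhenomena.Ising3D.Control2DGammaL7Cells1005F
import Summits.CriticalPhenomena.Ising3D.Control2DGammaL7Cells1005G
import Summits.CriticalPhenomena.Ising3D.Control2DGammaL7Cells1005H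
import Mathlib.Tactic.IntervalCases
import Mathlib.Tactic.Linarith
import Mathlib.Tactic.NormNum
import HarnessLib

/-!
# A second 2D γ-certificate in the kernel: `Δ_ε < 1.005` at `Δ_σ = 1/8` (the kernel's best 2D gap bound so far)
(cell `pub-ising3x`, seat controls-1 gen 15; KERNEL PATH for the 2D γ-certificates — CONTROL-ONLY)

HONEST FRAMING: lottery ticket; floor = tightest certified 3D Ising CFT bounds; no exact-solution
claim without a proof. CONTROL-ONLY: `d = 2`, global blocks, `Δ_σ = 1/8` exact, unitarity only; this
validates the certificate PIPELINE on the exactly solved 2D Ising model (`Δ_ε = 1`), nothing about `d = 3`.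

**`gapExcluded_2d_gamma_L7_e1005 : GapExcluded (1/8) (201 / 200)`** from the RB-1 derivative functional j106100
(Λ = 7, E₀ = 24, LP margin 2.85e-6), every obligation checked in the Lean kernel: (I) `ident_L7e1005`,
(R) `region_L7e1005`, (C) `cellN_L7e1005_sℓ` / `cellL7e1005_s2` (`ℓ = 0,…,22`; 32 levels and several Bernstein leaves for
`ℓ ≤ 6` — the functional nearly touches zero at the `ε'`-like scalar `Δ ≈ 4.3` —, 24 levels and one leaf
above). Since the truncation order now depends on the spin, the assembly is `gapExcluded_half_of_explicitN`,
the per-spin-`N` form of g14's `gapExcluded_half_of_explicit` (same proof). Improves the kernel's 2D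
control gap bound from `Δ_ε < 1.01` (`gapExcluded_2d_ising_101`, point functionals, controls-1 gen 6) to
`Δ_ε < 1.005` — a value the point-functional class could not certify (RB-0: 1.003–1.004 not certifiable at
K ≤ 59). Zero grant compute. No facts, standard axioms only.
-/

namespace Summit.CriticalPhenomena.Ising3D.Control2D

open Finset Set
open Literature.MathematicalPhysics.QuantumFieldTheory.ConformalBootstrap3D

/-- **Kind `gap` at `(1/2,1/2)`, explicit form with a spin-dependent truncation order** (`N₀` for the
scalar cells, `Nf ℓ` for spin `ℓ`, all `≥ E₀`); otherwise verbatim `gapExcluded_half_of_explicit`.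
[cite: RattazziEtAl2008, §5.5] -/
theorem gapExcluded_half_of_explicitN (S : Finset (ℕ × ℕ)) (w : ℕ × ℕ → ℝ) {s U E₀ : ℝ}
    (hs0 : 0 ≤ s) (hs1 : s < 1) (hU2 : 2 * s < U)
    (hI : 0 < taylorFunctional2D (1 / 2) S w (crossF s (-1) (fun _ _ => (1 : ℝ))))
    (hR : ∀ (b : ℝ) (J : ℕ), 0 ≤ b → E₀ ≤ 2 * b + J →
      0 ≤ ∑ p ∈ S, w p * ((1 - (-1 : ℝ) ^ (p.1 + p.2)) * 2 ^ (p.1 + p.2) *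
        (qFactor₁ s (b + J) p.1 * qFactor₁ s b p.2 + qFactor₁ s b p.1 * qFactor₁ s (b + J) p.2)))
    (hC0 : ∀ Δ : ℝ, U ≤ Δ → Δ < E₀ → ∃ N : ℕ, E₀ ≤ N ∧
      0 ≤ taylorFunctional2D (1 / 2) S w (crossF s (-1) (QN N 0 Δ)))
    (hCℓ : ∀ ℓ : ℕ, Even ℓ → ℓ ≠ 0 → ∀ Δ : ℝ, (ℓ : ℝ) ≤ Δ → Δ < E₀ → ∃ N : ℕ, E₀ ≤ N ∧
      0 ≤ taylorFunctional2D (1 / 2) S w (crossF s (-1) (QN N ℓ Δ))) :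
    GapExcluded s U := by
  have hφ := isTaylorFunctional_taylorFunctional2D (1 / 2) S w
  have hx0 : (0 : ℝ) < 1 / 2 := by norm_num
  have hx1 : (1 / 2 : ℝ) < 1 := by norm_num
  have hpair : PairPositiveAbove (taylorFunctional2D (1 / 2) S w) s E₀ :=
    pairPositiveAbove_half_of_poly S w hR
  refine GapObligations.gapExcluded_taylor (E₀ := E₀) hφ hx0 hx1 hU2 hs1 ⟨hI, ?_, ?_, ?_⟩
  · intro Δ hUΔ hΔE
    obtain ⟨N, hN, h⟩ := hC0 Δ hUΔ hΔE
    refine blockPositive_of_QN_nonneg_taylor hφ hx0 hx1 hpair (ℓ := 0) (N := N) ?_ ?_ h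
    · simp only [Nat.cast_zero]; linarith
    · linarith
  · intro ℓ hℓ hℓ0 Δ hℓΔ hΔE
    obtain ⟨N, hN, h⟩ := hCℓ ℓ hℓ hℓ0 Δ hℓΔ hΔE
    have : (0 : ℝ) ≤ ℓ := Nat.cast_nonneg ℓ
    exact blockPositive_of_QN_nonneg_taylor hφ hx0 hx1 hpair (N := N) hℓΔ (by linarith) h
  · exact fun ℓ _ Δ hℓΔ hE => high_nonneg_of_pairPositive_taylor hφ hx0 hx1 hpair ℓ Δ hℓΔ hE

/-- **2D control, γ-architecture, kernel-complete: `Δ_ε < 201 / 200` at `Δ_σ = 1/8`.** No `CrossingData`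
with `Δσ = 1/8` that `IsUnitary`, `SatisfiesCrossing` and `HasScalarGap (201 / 200)` exists — from the RB-1
derivative functional j106100 (Λ = 7, E₀ = 24) with every obligation ((I), (R), twelve spin cells)
checked in the Lean kernel. CONTROL-ONLY (d = 2). [cite: RattazziEtAl2008, §5.5] -/
theorem gapExcluded_2d_gamma_L7_e1005 : GapExcluded (1 / 8 : ℝ) (201 / 200) := by
  refine gapExcluded_half_of_explicitN slL7.toFinset (fun p => (wtL7e1005 p : ℝ)) (s := 1 / 8)
    (U := 201 / 200) (E₀ := 24) (by norm_num) (by norm_num) (by norm_num)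
    ident_L7e1005 (fun b J hb hE => region_L7e1005 b J hb hE)
    (fun Δ h1 h2 => cellN_L7e1005_s0 Δ h1 h2.le) ?_
  intro ℓ hℓ hℓ0 Δ hℓΔ hΔ
  have hℓ24R : (ℓ : ℝ) < 24 := lt_of_le_of_lt hℓΔ hΔ
  have hℓ24 : ℓ < 24 := by exact_mod_cast hℓ24R
  interval_cases ℓ
  · exact absurd rfl hℓ0
  · exact absurd hℓ (by decide)
  · exact ⟨28, by norm_num, cellL7e1005_s2 Δ (by exact_mod_cast hℓΔ) hΔ.le⟩
  · exact absurd hℓ (by decide)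
  · exact cellN_L7e1005_s4 Δ (by exact_mod_cast hℓΔ) hΔ.le
  · exact absurd hℓ (by decide)
  · exact cellN_L7e1005_s6 Δ (by exact_mod_cast hℓΔ) hΔ.le
  · exact absurd hℓ (by decide)
  · exact cellN_L7e1005_s8 Δ (by exact_mod_cast hℓΔ) hΔ.le
  · exact absurd hℓ (by decide)
  · exact cellN_L7e1005_s10 Δ (by exact_mod_cast hℓΔ) hΔ.le
  · exact absurd hℓ (by decide)
  · exact cellN_L7e1005_s12 Δ (by exact_mod_cast hℓΔ) hΔ.le
  · exact absurd hℓ (by decide)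
  · exact cellN_L7e1005_s14 Δ (by exact_mod_cast hℓΔ) hΔ.le
  · exact absurd hℓ (by decide)
  · exact cellN_L7e1005_s16 Δ (by exact_mod_cast hℓΔ) hΔ.le
  · exact absurd hℓ (by decide)
  · exact cellN_L7e1005_s18 Δ (by exact_mod_cast hℓΔ) hΔ.le
  · exact absurd hℓ (by decide)
  · exact cellN_L7e1005_s20 Δ (by exact_mod_cast hℓΔ) hΔ.le
  · exact absurd hℓ (by decide)
  · exact cellN_L7e1005_s22 Δ (by exact_mod_cast hℓΔ) hΔ.le
  · exact absurd hℓ (by decide)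

end Summit.CriticalPhenomena.Ising3D.Control2D
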